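import Summits.AtomisticToContinuum.Crystallization.Theorems.PricedLinkCensusLocalToGlobalFccMirrorSums
import Summits.AtomisticToContinuum.Crystallization.Theorems.PricedLinkCensusLocalToGlobalFccMirrorGeometry
import Mathlib.Analysis.Calculus.SmoothSeries

/-!
# Lattice sums of translates over `fcc(a)`: summability, continuity, differentiation, slab decay

Route `PricedLinkCensus`, crux `LocalToGlobal` (stmt-AtomisticToContinuum-14232), line
`flux-cell-joint-census`, support for the registered stub `stub_fccMirrorExact : NewtonShell8 → FccMirrorExact`
(`Theorems/PricedLinkCensusLocalToGlobalDefs`), second half (`fluxCell ≤ S₆`, the method of images).  The field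
and potential of the method of images are the lattice sums `z ↦ Σ'_{p ∈ fcc(a)} f(z - ι p)` of the smeared Newton
field / potential of one ball.  For a term `f : ℝ⁸ → F` with `‖f(y)‖ ≤ C (1 + ‖y‖)⁻ᵏ`, `k > 3`, indexed by the
countable type `↥(fccSet a)` (`≃ ℤ³` through `latVec`, `PricedLinkCensusLocalToGlobalFccMirrorSums`):

* the weights `p ↦ (1 + ‖z - ι p‖)⁻ᵏ` are summable (`p`-series on the rank-3 lattice), uniformly on slabs:
  `Σ'_p (1 + ‖x - p‖)⁻ᵏ ≤ S` for `‖x‖ ≤ R₀` (Peetre's inequality);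
* `Σ'_p f(z - ι p)` converges, is continuous if `f` is (locally uniform convergence), and has the transverse decay
  `‖Σ'_p f(z - ι p)‖ ≤ C S (1 + ‖perp z‖)⁻⁽ᵏ⁻⁴⁾` over bounded regions of `ℝ³` (registered sub-goal
  `fccMirror_latticeSum_slab_decay`);
* term-by-term differentiation: if `u` has gradient `g` with such bounds, `Σ'_p u(· - ι p)` has gradient
  `Σ'_p g(· - ι p)` (Mathlib `hasFDerivAt_tsum_of_isPreconnected` on unit balls).

References: folklore (lattice sums); E. M. Stein, G. Weiss, *Fourier analysis on Euclidean spaces* (1971),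
Ch. VII §2 (periodisation of decaying functions).
-/

noncomputable section

open MeasureTheory Set Filter Metric Topology InnerProductSpace Function
open scoped RealInnerProductSpace BigOperators

namespace Summit.AtomisticToContinuum.Crystallization.Theorems.PricedLinkCensusLocalToGlobal

/-! ### The index type `↥(fccSet a)` -/

section Index

variable {a : ℝ}

/-- `ℤ³ ≃ fcc(a)` through the basis coordinates (`a ≠ 0`). [folklore] -/
def fccEquiv (ha : a ≠ 0) : (Fin 3 → ℤ) ≃ fccSet a :=
  Equiv.ofBijective (fun j => ⟨latVec a j, latVec_mem_fccSet a j⟩)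
    ⟨fun j j' h => latVec_injective ha (congrArg Subtype.val h), fun p => by
      obtain ⟨j, hj⟩ := exists_latVec_eq p.2
      exact ⟨j, Subtype.ext hj⟩⟩

/-- The index type of the lattice sums is countable. [folklore] -/
theorem countable_fccSet (ha : a ≠ 0) : Countable (fccSet a) := Countable.of_equiv _ (fccEquiv ha)

/-- **Summability of the inverse powers over `fcc(a)`**: `Σ_p ‖p - x‖⁻ⁿ < ∞` for `n > 3`. [folklore] -/
theorem summable_inv_norm_sub_pow_fcc (ha : a ≠ 0) {n : ℕ} (hn : 3 < n) (x : E3) :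
    Summable fun p : fccSet a => ‖(p : E3) - x‖⁻¹ ^ n :=
  (Equiv.summable_iff (fccEquiv ha) (f := fun p : fccSet a => ‖(p : E3) - x‖⁻¹ ^ n)).1
    (summable_inv_norm_latVec_sub_pow ha hn x)

/-- Peetre's inequality on `ℝ³`: `(1 + ‖x - p‖)⁻¹ ≤ (1 + ‖x‖)(1 + ‖p‖)⁻¹`. [folklore] -/
theorem inv_one_add_norm_sub_le_E3 (x p : E3) : (1 + ‖x - p‖)⁻¹ ≤ (1 + ‖x‖) * (1 + ‖p‖)⁻¹ := by
  rw [inv_eq_one_div, inv_eq_one_div, mul_one_div, div_le_div_iff₀ (by positivity) (by positivity), one_mul]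
  have h1 : ‖p‖ ≤ ‖x - p‖ + ‖x‖ := by
    have := norm_sub_le x (x - p); rw [sub_sub_cancel] at this; linarith [norm_sub_rev x (x - p)]
  nlinarith [norm_nonneg (x - p), norm_nonneg x]

/-- **Summability of the weights** `p ↦ (1 + ‖x - p‖)⁻ᵏ` over `fcc(a)` for `k > 3`. [folklore] -/
theorem summable_weight_fcc (ha : a ≠ 0) {k : ℕ} (hk : 3 < k) (x : E3) :
    Summable fun p : fccSet a => (1 + ‖x - (p : E3)‖)⁻¹ ^ k := by
  refine Summable.of_norm_bounded_eventually (summable_inv_norm_sub_pow_fcc ha hk x) (Filter.eventually_cofinite.2 ?_)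
  have hsub : {p : fccSet a | ¬‖(1 + ‖x - (p : E3)‖)⁻¹ ^ k‖ ≤ ‖(p : E3) - x‖⁻¹ ^ k} ⊆ {p | (p : E3) = x} := by
    intro p hp
    by_contra hne
    apply hp
    rw [Real.norm_of_nonneg (by positivity), norm_sub_rev (p : E3) x]
    have hpos : 0 < ‖x - (p : E3)‖ := norm_pos_iff.2 (sub_ne_zero.2 (Ne.symm hne))
    exact pow_le_pow_left₀ (by positivity) (inv_anti₀ hpos (by linarith)) k
  have hss : ({p : fccSet a | (p : E3) = x} : Set (fccSet a)).Subsingleton := fun p hp q hq =>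
    Subtype.ext (hp.trans hq.symm)
  exact hss.finite.subset hsub

/-- **Summability of the weights on `ℝ⁸`**: `p ↦ (1 + ‖z - ι p‖)⁻ᵏ` for `k > 3`. [folklore] -/
theorem summable_weight_fcc8 (ha : a ≠ 0) {k : ℕ} (hk : 3 < k) (z : E8) :
    Summable fun p : fccSet a => (1 + ‖z - emb (p : E3)‖)⁻¹ ^ k := by
  refine (summable_weight_fcc ha hk (proj z)).of_nonneg_of_le (fun p => by positivity) fun p => ?_
  refine pow_le_pow_left₀ (by positivity) (inv_anti₀ (by positivity) ?_) k
  have h : ‖proj z - (p : E3)‖ ≤ ‖z - emb (p : E3)‖ := by rw [← proj_sub_emb]; exact norm_proj_le _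
  linarith

/-- **Uniform bound on slabs**: `Σ'_p (1 + ‖x - p‖)⁻ᵏ ≤ S` for all `‖x‖ ≤ R₀` (`k > 3`, `R₀ ≥ 0`). [folklore] -/
theorem exists_tsum_weight_le (ha : a ≠ 0) {k : ℕ} (hk : 3 < k) {R₀ : ℝ} (hR₀ : 0 ≤ R₀) :
    ∃ S : ℝ, 0 ≤ S ∧ ∀ x : E3, ‖x‖ ≤ R₀ → ∑' p : fccSet a, (1 + ‖x - (p : E3)‖)⁻¹ ^ k ≤ S := by
  have h0 := summable_weight_fcc ha hk 0
  simp only [zero_sub, norm_neg] at h0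
  refine ⟨(1 + R₀) ^ k * ∑' p : fccSet a, (1 + ‖(p : E3)‖)⁻¹ ^ k, by positivity, fun x hx => ?_⟩
  rw [← tsum_mul_left]
  refine Summable.tsum_le_tsum (fun p => ?_) (summable_weight_fcc ha hk x) (h0.mul_left _)
  rw [← mul_pow]
  refine pow_le_pow_left₀ (by positivity) ((inv_one_add_norm_sub_le_E3 x p).trans ?_) k
  exact mul_le_mul_of_nonneg_right (by linarith) (by positivity)

end Index

/-! ### Lattice sums of translates of a decaying term -/

section Translate

variable {a : ℝ} {F : Type*} [NormedAddCommGroup F] [CompleteSpace F]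

/-- **Summability** of `p ↦ f(z - ι p)` for `‖f(y)‖ ≤ C (1 + ‖y‖)⁻ᵏ`, `k > 3`. [folklore] -/
theorem summable_translate (ha : a ≠ 0) {f : E8 → F} {C : ℝ} {k : ℕ} (hk : 3 < k)
    (hf : ∀ y, ‖f y‖ ≤ C * (1 + ‖y‖)⁻¹ ^ k) (z : E8) : Summable fun p : fccSet a => f (z - emb (p : E3)) :=
  Summable.of_norm_bounded ((summable_weight_fcc8 ha hk z).mul_left C) fun _ => hf _

/-- Local uniform weights: `(1 + ‖z - e‖)⁻¹ ≤ 2 (1 + ‖z₀ - e‖)⁻¹` for `‖z - z₀‖ ≤ 1`. [folklore] -/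
theorem inv_one_add_norm_sub_le_local {z z₀ e : E8} (hz : ‖z - z₀‖ ≤ 1) : (1 + ‖z - e‖)⁻¹ ≤ 2 * (1 + ‖z₀ - e‖)⁻¹ := by
  rw [inv_eq_one_div, inv_eq_one_div, mul_one_div, div_le_div_iff₀ (by positivity) (by positivity), one_mul]
  have h1 : ‖z₀ - e‖ ≤ ‖z - e‖ + ‖z - z₀‖ := by
    have := norm_sub_le (z - e) (z - z₀); rw [sub_sub_sub_cancel_left] at this; linarith
  nlinarith [norm_nonneg (z - e)]

/-- **Continuity** of `z ↦ Σ'_p f(z - ι p)` for continuous `f` with `‖f(y)‖ ≤ C (1 + ‖y‖)⁻ᵏ`, `k > 3` (locally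
uniform convergence on unit balls). [folklore] -/
theorem continuous_tsum_translate (ha : a ≠ 0) {f : E8 → F} {C : ℝ} {k : ℕ} (hk : 3 < k)
    (hf : ∀ y, ‖f y‖ ≤ C * (1 + ‖y‖)⁻¹ ^ k) (hfc : Continuous f) :
    Continuous fun z => ∑' p : fccSet a, f (z - emb (p : E3)) := by
  have hC : 0 ≤ C := by
    have := (norm_nonneg _).trans (hf 0)
    rw [norm_zero, add_zero, inv_one, one_pow, mul_one] at this
    exact this
  refine continuous_iff_continuousAt.2 fun z₀ => ?_
  have hcont : ContinuousOn (fun z => ∑' p : fccSet a, f (z - emb (p : E3))) (ball z₀ 1) := by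
    refine continuousOn_tsum (fun p => (hfc.comp (continuous_id.sub continuous_const)).continuousOn)
      ((summable_weight_fcc8 ha hk z₀).mul_left (C * 2 ^ k)) fun p z hz => ?_
    refine (hf _).trans ?_
    rw [mul_assoc, ← mul_pow]
    exact mul_le_mul_of_nonneg_left (pow_le_pow_left₀ (by positivity)
      (inv_one_add_norm_sub_le_local (le_of_lt (mem_ball_iff_norm.1 hz))) k) hC
  exact hcont.continuousAt (ball_mem_nhds z₀ one_pos)

omit [CompleteSpace F] in
/-- **Transverse decay on slabs**: if `‖f(y)‖ ≤ C (1 + ‖y‖)⁻⁽ʲ⁺⁴⁾` then for `‖proj z‖ ≤ R₀`,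
`‖Σ'_p f(z - ι p)‖ ≤ C S (1 + ‖perp z‖)⁻ʲ` with the slab constant `S` of the weights of exponent `4`. [folklore] -/
theorem norm_tsum_translate_le_slab (ha : a ≠ 0) {f : E8 → F} {C : ℝ} {j : ℕ}
    (hf : ∀ y, ‖f y‖ ≤ C * (1 + ‖y‖)⁻¹ ^ (j + 4)) {R₀ S : ℝ}
    (hS : ∀ x : E3, ‖x‖ ≤ R₀ → ∑' p : fccSet a, (1 + ‖x - (p : E3)‖)⁻¹ ^ 4 ≤ S) {z : E8} (hz : ‖proj z‖ ≤ R₀) :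
    ‖∑' p : fccSet a, f (z - emb (p : E3))‖ ≤ C * S * (1 + ‖perpL z‖)⁻¹ ^ j := by
  have hC : 0 ≤ C := by
    have := (norm_nonneg _).trans (hf 0)
    rw [norm_zero, add_zero, inv_one, one_pow, mul_one] at this
    exact this
  have h4 : (3 : ℕ) < 4 := by norm_num
  have hw := summable_weight_fcc ha h4 (proj z)
  -- termwise: `(1 + ‖z - ι p‖)⁻⁽ʲ⁺⁴⁾ ≤ (1 + ‖perp z‖)⁻ʲ (1 + ‖proj z - p‖)⁻⁴`
  have hterm : ∀ p : fccSet a, ‖f (z - emb (p : E3))‖ ≤ C * (1 + ‖perpL z‖)⁻¹ ^ j * (1 + ‖proj z - (p : E3)‖)⁻¹ ^ 4 :=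
    fun p => by
    refine (hf _).trans ?_
    rw [pow_add, mul_assoc]
    have hsq := norm_sub_emb_sq z (p : E3)
    have h1 : ‖perpL z‖ ≤ ‖z - emb (p : E3)‖ := by nlinarith [norm_nonneg (perpL z), norm_nonneg (z - emb (p : E3)), sq_nonneg ‖proj z - (p : E3)‖]
    have h2 : ‖proj z - (p : E3)‖ ≤ ‖z - emb (p : E3)‖ := by nlinarith [norm_nonneg (perpL z), norm_nonneg (z - emb (p : E3)), norm_nonneg (proj z - (p : E3)), sq_nonneg ‖perpL z‖]
    refine mul_le_mul_of_nonneg_left (mul_le_mul (pow_le_pow_left₀ (by positivity) (inv_anti₀ (by positivity) (by linarith)) j)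
      (pow_le_pow_left₀ (by positivity) (inv_anti₀ (by positivity) (by linarith)) 4) (by positivity) (by positivity)) hC
  have hsum : Summable fun p : fccSet a => C * (1 + ‖perpL z‖)⁻¹ ^ j * (1 + ‖proj z - (p : E3)‖)⁻¹ ^ 4 := hw.mul_left _
  calc ‖∑' p : fccSet a, f (z - emb (p : E3))‖ ≤ ∑' p : fccSet a, ‖f (z - emb (p : E3))‖ :=
        norm_tsum_le_tsum_norm (Summable.of_nonneg_of_le (fun _ => norm_nonneg _) hterm hsum)
    _ ≤ ∑' p : fccSet a, C * (1 + ‖perpL z‖)⁻¹ ^ j * (1 + ‖proj z - (p : E3)‖)⁻¹ ^ 4 :=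
        Summable.tsum_le_tsum hterm (Summable.of_nonneg_of_le (fun _ => norm_nonneg _) hterm hsum) hsum
    _ = C * (1 + ‖perpL z‖)⁻¹ ^ j * ∑' p : fccSet a, (1 + ‖proj z - (p : E3)‖)⁻¹ ^ 4 := tsum_mul_left
    _ ≤ C * (1 + ‖perpL z‖)⁻¹ ^ j * S := mul_le_mul_of_nonneg_left (hS _ hz) (by positivity)
    _ = C * S * (1 + ‖perpL z‖)⁻¹ ^ j := by ring

/-- **Term-by-term differentiation**: if `u : ℝ⁸ → ℝ` has gradient `g` everywhere, `g` continuous,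
`‖g(y)‖ ≤ C (1 + ‖y‖)⁻ᵏ` and `|u(y)| ≤ C' (1 + ‖y‖)⁻ᵏ'` with `k, k' > 3`, then `Σ'_p u(· - ι p)` has gradient
`Σ'_p g(· - ι p)`. [folklore] -/
theorem hasFDerivAt_tsum_translate (ha : a ≠ 0) {u : E8 → ℝ} {g : E8 → E8} {C C' : ℝ} {k k' : ℕ} (hk : 3 < k)
    (hk' : 3 < k') (hu : ∀ y, HasFDerivAt u (InnerProductSpace.toDual ℝ E8 (g y)) y)
    (hg : ∀ y, ‖g y‖ ≤ C * (1 + ‖y‖)⁻¹ ^ k) (hu' : ∀ y, |u y| ≤ C' * (1 + ‖y‖)⁻¹ ^ k') (z : E8) :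
    HasFDerivAt (fun z => ∑' p : fccSet a, u (z - emb (p : E3)))
      (InnerProductSpace.toDual ℝ E8 (∑' p : fccSet a, g (z - emb (p : E3)))) z := by
  have hC : 0 ≤ C := by
    have := (norm_nonneg _).trans (hg 0)
    rw [norm_zero, add_zero, inv_one, one_pow, mul_one] at this
    exact this
  -- summability of the gradients at `z`, and the limit through `toDual`
  have hgs : Summable fun p : fccSet a => g (z - emb (p : E3)) := summable_translate ha hk hg z
  have hmap : HasSum (fun p : fccSet a => InnerProductSpace.toDual ℝ E8 (g (z - emb (p : E3))))
      (InnerProductSpace.toDual ℝ E8 (∑' p : fccSet a, g (z - emb (p : E3)))) :=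
    hgs.hasSum.map (InnerProductSpace.toDual ℝ E8) (InnerProductSpace.toDual ℝ E8).continuous
  rw [← hmap.tsum_eq]
  refine hasFDerivAt_tsum_of_isPreconnected (f := fun (p : fccSet a) (y : E8) => u (y - emb (p : E3)))
    (f' := fun (p : fccSet a) (y : E8) => InnerProductSpace.toDual ℝ E8 (g (y - emb (p : E3))))
    (u := fun p : fccSet a => C * 2 ^ k * (1 + ‖z - emb (p : E3)‖)⁻¹ ^ k)
    ((summable_weight_fcc8 ha hk z).mul_left (C * 2 ^ k)) isOpen_ball (convex_ball z 1).isPreconnected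
    (fun p y _ => ?_) (fun p y hy => ?_) (mem_ball_self one_pos) ?_ (mem_ball_self one_pos)
  · exact (hu (y - emb (p : E3))).comp y ((hasFDerivAt_id y).sub_const (emb (p : E3)))
  · rw [LinearIsometryEquiv.norm_map]
    refine (hg _).trans ?_
    rw [mul_assoc, ← mul_pow]
    exact mul_le_mul_of_nonneg_left (pow_le_pow_left₀ (by positivity)
      (inv_one_add_norm_sub_le_local (le_of_lt (mem_ball_iff_norm.1 hy))) k) hC
  · exact summable_translate ha hk' (f := u) (fun y => by rw [Real.norm_eq_abs]; exact hu' y) z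

/-- **Registered sub-goal `fccMirror_latticeSum_slab_decay`** (line `flux-cell-joint-census`, support of
`stub_fccMirrorExact`): transverse decay of lattice sums of translates of a decaying term over bounded regions
of `ℝ³`, binder form of `norm_tsum_translate_le_slab` for `ℝ⁸`-valued terms. [folklore] -/
theorem fccMirror_latticeSum_slab_decay : ∀ (a : ℝ), a ≠ 0 → ∀ (f : E8 → E8) (C : ℝ) (j : ℕ),
    (∀ y, ‖f y‖ ≤ C * (1 + ‖y‖)⁻¹ ^ (j + 4)) → ∀ (R₀ S : ℝ),
    (∀ x : E3, ‖x‖ ≤ R₀ → ∑' p : fccSet a, (1 + ‖x - (p : E3)‖)⁻¹ ^ 4 ≤ S) → ∀ z : E8, ‖proj z‖ ≤ R₀ →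
    ‖∑' p : fccSet a, f (z - emb (p : E3))‖ ≤ C * S * (1 + ‖perpL z‖)⁻¹ ^ j :=
  fun _ ha _ _ _ hf _ _ hS _ hz => norm_tsum_translate_le_slab ha hf hS hz

end Translate

end Summit.AtomisticToContinuum.Crystallization.Theorems.PricedLinkCensusLocalToGlobal

end
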